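import Literature.IUT.LogThetaLattice.GlobalLGPFrobenioidsRealifiedPlacesNormalizedDefs
import Literature.IUT.LogThetaLattice.GlobalLGPFrobenioidsRealifiedPlacesNormalized
import HarnessLib

/-!
# [IUTchIII] Prop. 3.7 (iv) «Prime(†𝒞^⊩_lgp) ⥲ V̲», [IUTchI] Ex. 3.5 (i): the primes dictionary of the categorical
# `(†𝓕⊛ℝ_𝔪𝔬𝔡)_α` is UNCHANGED by the `e_v`-normalisation (PROOF-ONLY companion of `…RealifiedPlacesNormalizedDefs`)

S. Mochizuki, *Inter-universal Teichmüller theory III*, Prop. 3.7 (iv) p. 111 ("`Prime(†𝒞^⊩_lgp) ⥲ V̲`")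
[claim key Mochizuki2012, status disputed (D-0012)]; *Inter-universal Teichmüller theory I*, §3, Ex. 3.5 (i), kurims
manuscript (May 2020) p. 84 ("`Prime(𝒞^⊩_mod) ⥲ V_mod`", "`log⊢_mod(p_v)`", "`ρ_v`"); S. Mochizuki, *The geometry of
Frobenioids I*, Kyushu J. Math. **62** (2008), §0 p. 12 ("`Prime(M)`": `≼`-classes of primary elements)
[cite: MochizukiFrdI2008, §0 p.12].

abc-iut cell, layer L6, wave-5 seat abc-iut-w5-d153 (gen 3); PROOF-ONLY (no `def`, no instance).  Companion of the
owner-lineage repair `GlobalLGPFrobenioidsRealifiedPlacesNormalizedDefs.lean` of finding F-w4d073g4-1: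
* generic (`FinsuppNNReal`): `isPrimary_single_of_ne_zero`, **`primesEquiv_mk_single_of_ne_zero`** — the prime of
  `single i x` (`x ≠ 0`) under abc-iut-w4-d013's `Prime(ι →₀ ℝ_{≥0}) ≃ ι` is `i` (rescaling a primary element does not move
  its prime);
* **`primesEquivVal_eq_congr_norm`**: part H's primes dictionary `primesEquivVal F : Prime(Φ^ℝ(∗)) ≃ V(F)` (= the transport
  of `FinsuppNNReal.primesEquiv` along the UN-normalised `effDivAddEquivVal`, `primesEquivVal_eq_congr`) is ALSO the
  transport along the NORMALISED `effDivAddEquivValNorm` — coordinate scalings do not move primes, so "`Prime(†𝒞^⊩_lgp) ⥲ V̲`"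
  needs no repair; at `F_mod`: `primesEquivVal_fieldOfModuli_eq_norm` (matches abc-iut-w4-d013's `primesLgpEquiv` shape);
* **`eq_effDivAddEquivValNorm_of_realifyEff_effDivOfArith`** (abc-iut-w4-d073's uniqueness
  `effDivAddEquivVal_normalized_unique` in named-def form): ANY additive isomorphism `Φ^ℝ(∗) ≃+ (V(F) →₀ ℝ_{≥0})` under which
  the L6 route becomes abc-iut-w4-d050's `realifyMod` IS `effDivAddEquivValNorm F`; `choose_exists_effDivAddEquivVal_normalized_eq`
  (his ∃-witness is this map); `effDivAddEquivVal_ne_norm_of_ramified` / `effDivAddEquivVal_eq_norm_of_unramified` (part H's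
  dictionary differs from the normalised one iff `F` is somewhere ramified over `ℚ`);
* `effDivAddEquivValNorm_spec` (abc-iut-w4-d073's ∃-statement `exists_effDivAddEquivVal_normalized_realifyMod` witnessed BY
  NAME), `…_symm_single_inl_one`, `effDivEquivPhiModNorm_delta_inl/_delta_inr/_symm_logMod_arch`, `rhoLgpNorm_delta`
  (`δ_𝔭 ↦ e_v⁻¹ · [K_w:(F_mod)_v]⁻¹`).
No new Prop fact; no statement of the paper is strengthened; nothing here asserts a disputed claim or takes a side on
[IUTchIII] Cor. 3.12; typed ≠ discharged.
-/

noncomputable section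

namespace Literature.IUT.LogThetaLattice

open NumberField IsDedekindDomain GlobalFrobenioidModels Literature.AlgebraicGeometry.Frobenioids
  Literature.IUT.HodgeTheaters
open scoped NNReal

/-! ### Generic: rescaling a primary element of `ι →₀ ℝ_{≥0}` does not move its prime -/

namespace FinsuppNNReal

variable {ι : Type*}

/-- `single i x` with `x ≠ 0` is a PRIMARY element of `ι →₀ ℝ_{≥0}` ([FrdI] §0): its support is `{i}`.
[cite: MochizukiFrdI2008, §0 p.12] -/
theorem isPrimary_single_of_ne_zero (i : ι) {x : ℝ≥0} (hx : x ≠ 0) :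
    IsPrimary (Multiplicative.ofAdd (Finsupp.single i x)) :=
  isPrimary_iff.2 ⟨i, Finsupp.support_single _ hx⟩

/-- **The prime of `single i x` (`x ≠ 0`) is `i`** under `Prime(ι →₀ ℝ_{≥0}) ≃ ι`: rescaling a primary element does not
change its prime (`single i x ≼ single i 1 ≼ single i x`). [cite: MochizukiFrdI2008, §0 p.12] -/
theorem primesEquiv_mk_single_of_ne_zero (i : ι) {x : ℝ≥0} (hx : x ≠ 0)
    (h : IsPrimary (Multiplicative.ofAdd (Finsupp.single i x))) :
    primesEquiv (Quotient.mk (primarySetoid _) ⟨Multiplicative.ofAdd (Finsupp.single i x), h⟩) = i := by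
  have hcls : Quotient.mk (primarySetoid (Multiplicative (ι →₀ ℝ≥0)))
        ⟨Multiplicative.ofAdd (Finsupp.single i x), h⟩ =
      Quotient.mk (primarySetoid _) ⟨Multiplicative.ofAdd (Finsupp.single i (1 : ℝ≥0)), isPrimary_single i⟩ := by
    apply Quotient.sound
    change Multiplicative.ofAdd (Finsupp.single i x) ≼ Multiplicative.ofAdd (Finsupp.single i (1 : ℝ≥0))
    rw [precsim_iff_support_subset, Finsupp.support_single _ hx, Finsupp.support_single _ one_ne_zero]
  rw [hcls, primesEquiv_mk_single]

end FinsuppNNReal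

namespace Prop37

namespace FrakRlfCat

variable (F : Type) [Field F] [NumberField F]

/-! ### The normalised dictionary: ∃-spec and the archimedean unit -/

/-- The ∃-statement of abc-iut-w4-d073's `exists_effDivAddEquivVal_normalized_realifyMod`, witnessed BY NAME by
`effDivAddEquivValNorm F`. ([IUTchI] Ex 3.5 (i) p.84) [claim: Mochizuki2012, status: disputed] -/
theorem effDivAddEquivValNorm_spec :
    (∀ a : EffArithDivisor F,
        effDivAddEquivValNorm F (realifyEff F (effDivOfArith F a)) = EffArithDivisor.realifyMod F a) ∧
      (∀ (D : effDiv (ModelPlaces F) (fun _ => ℝ) nonnegModel) (w : InfinitePlace F),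
          effDivAddEquivValNorm F D (Sum.inl w : Val F) = effDivAddEquivVal F D (Sum.inl w : Val F)) ∧
      ∀ (D : effDiv (ModelPlaces F) (fun _ => ℝ) nonnegModel) (v : FinitePlace F),
          effDivAddEquivValNorm F D (Sum.inr v : Val F) =
            (absRamIdx F v : ℝ≥0)⁻¹ * effDivAddEquivVal F D (Sum.inr v : Val F) :=
  ⟨effDivAddEquivValNorm_realifyEff_effDivOfArith F, effDivAddEquivValNorm_apply_inl F,
    effDivAddEquivValNorm_apply_inr F⟩

/-- **Uniqueness**: ANY additive isomorphism with w4-d073's two coordinate properties is `effDivAddEquivValNorm F` — so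
the ∃ of `exists_effDivAddEquivVal_normalized_realifyMod` is a ∃!. ([IUTchI] Ex 3.5 (i) p.84)
[claim: Mochizuki2012, status: disputed] -/
theorem existsUnique_effDivAddEquivVal_normalized :
    ∃! Θ : effDiv (ModelPlaces F) (fun _ => ℝ) nonnegModel ≃+ (Val F →₀ ℝ≥0),
      (∀ (D : effDiv (ModelPlaces F) (fun _ => ℝ) nonnegModel) (w : InfinitePlace F),
          Θ D (Sum.inl w : Val F) = effDivAddEquivVal F D (Sum.inl w : Val F)) ∧
        ∀ (D : effDiv (ModelPlaces F) (fun _ => ℝ) nonnegModel) (v : FinitePlace F),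
          Θ D (Sum.inr v : Val F) = (absRamIdx F v : ℝ≥0)⁻¹ * effDivAddEquivVal F D (Sum.inr v : Val F) :=
  ⟨effDivAddEquivValNorm F, ⟨effDivAddEquivValNorm_apply_inl F, effDivAddEquivValNorm_apply_inr F⟩,
    fun _ h => eq_effDivAddEquivValNorm F h.1 h.2⟩

/-- Under the inverse dictionary the unit vector at an archimedean place is `δ_𝔭` itself.
([IUTchI] Ex 3.5 (i) p.84) [claim: Mochizuki2012, status: disputed] -/
theorem effDivAddEquivValNorm_symm_single_inl_one (w : InfinitePlace F) :
    (effDivAddEquivValNorm F).symm (Finsupp.single (α := Val F) (Sum.inl w) 1) = delta F (Sum.inr w) :=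
  (effDivAddEquivValNorm F).injective (by rw [AddEquiv.apply_symm_apply, effDivAddEquivValNorm_delta_inr])

/-! ### Rigidity (abc-iut-w4-d073's uniqueness, in named-def form) -/

/-- **Any additive isomorphism `Φ^ℝ(∗) ≃+ (V(F) →₀ ℝ_{≥0})` under which the L6 route `Φ(F) → Φ(∗) → Φ^ℝ(∗)` becomes the
layer-L1/L5 realification map `realifyMod` IS `effDivAddEquivValNorm F`** — abc-iut-w4-d073's uniqueness
`effDivAddEquivVal_normalized_unique` applied to the named witness: the `e_v`-normalisation is forced by compatibility
with the realification map alone. ([IUTchI] Ex 3.5 (i) p.84) [claim: Mochizuki2012, status: disputed] -/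
theorem eq_effDivAddEquivValNorm_of_realifyEff_effDivOfArith
    {Θ : effDiv (ModelPlaces F) (fun _ => ℝ) nonnegModel ≃+ (Val F →₀ ℝ≥0)}
    (h : ∀ a : EffArithDivisor F, Θ (realifyEff F (effDivOfArith F a)) = EffArithDivisor.realifyMod F a) :
    Θ = effDivAddEquivValNorm F :=
  effDivAddEquivVal_normalized_unique F h (effDivAddEquivValNorm_realifyEff_effDivOfArith F)

/-- The witness of abc-iut-w4-d073's `existsUnique_effDivAddEquivVal_normalized_realifyMod`, chosen classically, is
`effDivAddEquivValNorm F`. ([IUTchI] Ex 3.5 (i) p.84) [claim: Mochizuki2012, status: disputed] -/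
theorem choose_exists_effDivAddEquivVal_normalized_eq :
    (exists_effDivAddEquivVal_normalized_realifyMod F).choose = effDivAddEquivValNorm F :=
  eq_effDivAddEquivValNorm_of_realifyEff_effDivOfArith F (exists_effDivAddEquivVal_normalized_realifyMod F).choose_spec.1

/-- Part H's UN-normalised `effDivAddEquivVal` differs from the normalised dictionary as soon as `F` has a finite place
ramified over `ℚ` (abc-iut-w4-d073's `…_single_inr_ne_realifyMod`, restated for the named maps).
([IUTchI] Ex 3.5 (i) p.84) [claim: Mochizuki2012, status: disputed] -/
theorem effDivAddEquivVal_ne_norm_of_ramified {v : FinitePlace F} (hv : absRamIdx F v ≠ 1) :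
    effDivAddEquivVal F ≠ effDivAddEquivValNorm F := by
  intro h
  apply effDivAddEquivVal_realifyEff_effDivOfArith_single_inr_ne_realifyMod F hv
  rw [h, effDivAddEquivValNorm_realifyEff_effDivOfArith]

/-- Conversely, over a number field UNRAMIFIED over `ℚ` at every finite place (e.g. `F = ℚ`) the two dictionaries COINCIDE —
the finding is invisible there. ([IUTchI] Ex 3.5 (i) p.84) [claim: Mochizuki2012, status: disputed] -/
theorem effDivAddEquivVal_eq_norm_of_unramified (hF : ∀ v : FinitePlace F, absRamIdx F v = 1) :
    effDivAddEquivVal F = effDivAddEquivValNorm F := by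
  refine AddEquiv.ext fun D => Finsupp.ext fun q => ?_
  rcases q with w | v
  · rw [effDivAddEquivValNorm_apply_inl]
  · rw [effDivAddEquivValNorm_apply_inr, hF v, Nat.cast_one, inv_one, one_mul]

/-! ### The primes dictionary is unchanged by the normalisation -/

/-- `δ_𝔭` goes to a PRIMARY element under the normalised dictionary (a nonzero multiple of a unit vector).
([FrdI] §0 p.12) [claim: Mochizuki2012, status: disputed] -/
theorem isPrimary_effDivAddEquivValNorm_delta (p : ModelPlaces F) :
    IsPrimary (Multiplicative.ofAdd (effDivAddEquivValNorm F (delta F p))) := by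
  rw [effDivAddEquivValNorm_delta]
  exact FinsuppNNReal.isPrimary_single_of_ne_zero _ (normWeight_ne_zero F _)

/-- **`Prime(Φ^ℝ(∗)) ≃ V(F)` is ALSO the transport of `FinsuppNNReal.primesEquiv` along the NORMALISED dictionary**:
coordinate scalings do not move primes, so part H's `primesEquivVal` (= part D's `primesEquivPlaces` + the places
dictionary = the transport along the un-normalised `effDivAddEquivVal`, `primesEquivVal_eq_congr`) needs no repair.
([IUTchIII] Prop 3.7 (iv) p.111; [FrdI] §0 p.12) [claim: Mochizuki2012, status: disputed] -/
theorem primesEquivVal_eq_congr_norm :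
    primesEquivVal F =
      (Primes.congr (AddEquiv.toMultiplicative (effDivAddEquivValNorm F))).trans FinsuppNNReal.primesEquiv := by
  refine Equiv.ext fun 𝔭 => ?_
  obtain ⟨q, rfl⟩ := (primesEquivVal F).symm.surjective 𝔭
  rw [Equiv.apply_symm_apply, primesEquivVal_symm_apply, Equiv.trans_apply,
    Primes.congr_mk _ _ (isPrimary_delta F _) (isPrimary_effDivAddEquivValNorm_delta F _)]
  symm
  change FinsuppNNReal.primesEquiv (Quotient.mk (primarySetoid _)
    ⟨Multiplicative.ofAdd (effDivAddEquivValNorm F (delta F ((modelPlacesEquivVal F).symm q))),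
      isPrimary_effDivAddEquivValNorm_delta F _⟩) = q
  have key : ∀ (a : Val F →₀ ℝ≥0) (ha : IsPrimary (Multiplicative.ofAdd a))
      (_ : a = Finsupp.single q (normWeight F q)),
      FinsuppNNReal.primesEquiv (Quotient.mk (primarySetoid _) ⟨Multiplicative.ofAdd a, ha⟩) = q := by
    rintro a ha rfl
    exact FinsuppNNReal.primesEquiv_mk_single_of_ne_zero q (normWeight_ne_zero F q) ha
  exact key _ _ (by rw [effDivAddEquivValNorm_delta, Equiv.apply_symm_apply])

/-- The two transports (un-normalised, part H; normalised, here) of `FinsuppNNReal.primesEquiv` COINCIDE.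
([IUTchIII] Prop 3.7 (iv) p.111) [claim: Mochizuki2012, status: disputed] -/
theorem primes_congr_norm_eq_congr :
    (Primes.congr (AddEquiv.toMultiplicative (effDivAddEquivValNorm F))).trans FinsuppNNReal.primesEquiv =
      (Primes.congr (AddEquiv.toMultiplicative (effDivAddEquivVal F))).trans FinsuppNNReal.primesEquiv := by
  rw [← primesEquivVal_eq_congr_norm, ← primesEquivVal_eq_congr]

/-! ### At an initial Θ-datum -/

section InitialTheta

variable {F₀ K Fbar : Type} [Field F₀] [NumberField F₀] [Field K] [NumberField K] [Algebra F₀ K] [Field Fbar]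
  [Algebra F₀ Fbar] [Algebra K Fbar] {E : WeierstrassCurve F₀} [E.IsElliptic] {l : ℕ} {P : BadPlacePredicates K}
  (D : InitialThetaData F₀ K Fbar E l P)

/-- `δ_𝔭 ↦ e_v⁻¹ • logMod v` for the maximal ideal `𝔭` of the finite place `v` of `F_mod`.
([IUTchI] Ex 3.5 (i) p.84) [claim: Mochizuki2012, status: disputed] -/
theorem effDivEquivPhiModNorm_delta_inl (v : HeightOneSpectrum (𝓞 (fieldOfModuli E))) :
    effDivEquivPhiModNorm D (delta (fieldOfModuli E) (Sum.inl v)) =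
      (absRamIdx (fieldOfModuli E) (FinitePlace.mk v) : ℝ≥0)⁻¹ • D.logMod (Sum.inr (FinitePlace.mk v)) := by
  show effDivAddEquivValNorm (fieldOfModuli E) _ = _
  rw [effDivAddEquivValNorm_delta_inl, D.smul_logMod _ (Sum.inr (FinitePlace.mk v))]

/-- `δ_𝔭 ↦ logMod v` at an archimedean place. ([IUTchI] Ex 3.5 (i) p.84) [claim: Mochizuki2012, status: disputed] -/
theorem effDivEquivPhiModNorm_delta_inr (w : InfinitePlace (fieldOfModuli E)) :
    effDivEquivPhiModNorm D (delta (fieldOfModuli E) (Sum.inr w)) = D.logMod (Sum.inl w) :=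
  effDivAddEquivValNorm_delta_inr (fieldOfModuli E) w

/-- `logMod v ↦ δ_𝔭` at an archimedean `v`. ([IUTchI] Ex 3.5 (i) p.84) [claim: Mochizuki2012, status: disputed] -/
theorem effDivEquivPhiModNorm_symm_logMod_arch (w : InfinitePlace (fieldOfModuli E)) :
    (effDivEquivPhiModNorm D).symm (D.logMod (Sum.inl w)) = delta (fieldOfModuli E) (Sum.inr w) :=
  effDivAddEquivValNorm_symm_single_inl_one (fieldOfModuli E) w

/-- **`Prime((†𝓕⊛ℝ_𝔪𝔬𝔡)_α) ⥲ V_mod` agrees with the NORMALISED `Φ_{𝒞⊩_mod}`-coordinates** as well (so it still matches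
abc-iut-w4-d013's `primesLgpEquiv` / abc-iut-L5-t2's `Prime(𝒞^⊩_mod) ⥲ V_mod`). ([IUTchIII] Prop 3.7 (iv) p.111)
[claim: Mochizuki2012, status: disputed] -/
theorem primesEquivVal_fieldOfModuli_eq_norm :
    primesEquivVal (fieldOfModuli E) =
      (Primes.congr (AddEquiv.toMultiplicative (effDivEquivPhiModNorm D))).trans FinsuppNNReal.primesEquiv :=
  primesEquivVal_eq_congr_norm (fieldOfModuli E)

/-- `†ρ_{lgp,v}` (normalised) on part D's `δ_𝔭` at the maximal ideal of `v = toVMod w`: `e_v⁻¹ · [K_w:(F_mod)_v]⁻¹`.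
([IUTchI] Ex 3.5 (i) p.84) [claim: Mochizuki2012, status: disputed] -/
theorem rhoLgpNorm_delta {w : Val K} {v : FinitePlace (fieldOfModuli E)} (hv : toVMod F₀ K E w = Sum.inr v) :
    Multiplicative.toAdd (rhoLgpNorm D w (Multiplicative.ofAdd
      (delta (fieldOfModuli E) (Sum.inl (FinitePlace.maximalIdeal v))))) =
      (absRamIdx (fieldOfModuli E) v : ℝ≥0)⁻¹ * D.rhoScalar w := by
  rw [rhoLgpNorm_ofAdd, effDivEquivPhiModNorm_delta_inl, FinitePlace.mk_maximalIdeal, hv]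
  show D.rhoScalar w * ((absRamIdx (fieldOfModuli E) v : ℝ≥0)⁻¹ • D.logMod (Sum.inr v)) (Sum.inr v) = _
  rw [D.smul_logMod_apply_self _ (Sum.inr v), mul_comm]

/-- `†ρ_{lgp,v}` (normalised) VANISHES on `δ_𝔭` for a model place `p` NOT under `w` (`ρ_w` reads the `v`-coordinate only).
([IUTchI] Ex 3.5 (i) p.84) [claim: Mochizuki2012, status: disputed] -/
theorem rhoLgpNorm_delta_of_ne {w : Val K} {p : ModelPlaces (fieldOfModuli E)}
    (hp : modelPlacesEquivVal (fieldOfModuli E) p ≠ toVMod F₀ K E w) :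
    Multiplicative.toAdd (rhoLgpNorm D w (Multiplicative.ofAdd (delta (fieldOfModuli E) p))) = 0 := by
  rw [rhoLgpNorm_ofAdd]
  show D.rho w (effDivAddEquivValNorm (fieldOfModuli E) (delta (fieldOfModuli E) p) (toVMod F₀ K E w)) = 0
  rw [effDivAddEquivValNorm_delta, Finsupp.single_eq_of_ne (Ne.symm hp), map_zero]

end InitialTheta

end FrakRlfCat

end Prop37

end Literature.IUT.LogThetaLattice

end
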